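import Summits.BirchSwinnertonDyer.BirchSwinnertonDyer.Theses.TameQuarticManinParity
import Summits.BirchSwinnertonDyer.BirchSwinnertonDyer.Theorems.TameQuarticManinParityTwistPairAtThree
import Literature.NumberTheory.EllipticCurves.ThreeTorsionIrreducibleInertiaShapeKodairaThreeProofs
import HarnessLib

/-!
# Route `TameQuarticManinParity`: W23b `TprimeIrrKodairaThreeSerreWeightSix` (stmt-BirchSwinnertonDyer-28281) and
# W23a `TprimeIrrKodairaThreeStarSerreWeightTwo` (stmt-BirchSwinnertonDyer-28283) BY NAME

Lead seat `cruxlead-stmt-BirchSwinnertonDyer-23367` (crux MS, line `abelian-fixed-points`): W23b is the single external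
input of the leaf L31 `TprimeIrrLevelThirdAvoidsThree` (stmt-23690) below MS (critic #192; typer tqmp-ty1 g29 copy ask).
THEOREMS ONLY (no definition, no named fact, no `sorry`): both statements are two-line compositions of results already
in the tree —

* `TwistPairAtThree.kodairaSymbolAt_and_padicValInt_of_subTprime` (bsd-wall): on the tame quartic class (t′) at `3`
  (`Addv W 3 ∧ SubTprime W 3`) a globally minimal `W` is Kodaira `III` with `ord₃ Δ_min = 3` or `III*` with
  `ord₃ Δ_min = 9`;
* `serreWeight_three_eq_six_of_kodairaSymbolAt_III` / `serreWeight_three_eq_two_of_kodairaSymbolAt_IIIstar`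
  (typer g27, `ThreeTorsionIrreducibleInertiaShapeKodairaThreeProofs`): Serre weight `6` on type `III`, `2` on type
  `III*`, for every framing of `E[3]`, every `j : 𝔽₃ → k`, every local restriction datum and residue embedding.

The hypothesis `W.HasIrreducibleModPGaloisRep 3` of the items is not used by the proofs (the typer's theorems cover both
local cases). No summit is proved; BSD is NOT proved.
-/

set_option autoImplicit false
-- D-0017: single-problem summit, so `Summit.BirchSwinnertonDyer.BirchSwinnertonDyer.…` repeats a namespace BY DESIGN.
set_option linter.dupNamespace false

noncomputable section

open IsDedekindDomain Rat.HeightOneSpectrum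
open Literature.NumberTheory.EllipticCurves Literature.NumberTheory.GaloisRepresentations
open Summit.BirchSwinnertonDyer.Rank1Residual.Additive

namespace Summit.BirchSwinnertonDyer.BirchSwinnertonDyer.Theorems.TameQuarticManinParity

open Summit.BirchSwinnertonDyer.BirchSwinnertonDyer.Theses.TameQuarticManinParity

/-- The place `placeOf 3` of `ℤ` lies over the rational prime `3`. [folklore] -/
theorem primesEquiv_placeOf_three_val :
    haveI : Fact (Nat.Prime 3) := ⟨Nat.prime_three⟩
    ((primesEquiv (R := ℤ) (placeOf 3) : Nat.Primes) : ℕ) = 3 := by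
  haveI : Fact (Nat.Prime 3) := ⟨Nat.prime_three⟩
  exact congrArg Subtype.val ((primesEquiv (R := ℤ)).apply_symm_apply ⟨3, Nat.prime_three⟩)

/-- **W23b `TprimeIrrKodairaThreeSerreWeightSix` (stmt-BirchSwinnertonDyer-28281) by name**: on the tame quartic class
at `3` with `ord₃ Δ_min = 3` the curve is Kodaira `III` (the `III*` alternative has `ord₃ Δ_min = 9`), and on type
`III` every framed model of `E[3] ⊗ k` has Serre weight `6` at every local restriction datum.
[cite: ConradDiamondTaylor1999, §7.2, proof of Thm. 7.2.1 (p. 553)] -/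
theorem tprimeIrrKodairaThreeSerreWeightSix_proof : TprimeIrrKodairaThreeSerreWeightSix := by
  intro W _ _ hadd hsub _hirr hv ρ hρ k _ _ _ _ _ j loc ι
  haveI : Fact (Nat.Prime 3) := ⟨Nat.prime_three⟩
  rcases TwistPairAtThree.kodairaSymbolAt_and_padicValInt_of_subTprime W hadd hsub with ⟨hK, -⟩ | ⟨-, h9⟩
  · exact ThreeTorsionIrreducibleShape.serreWeight_three_eq_six_of_kodairaSymbolAt_III W (placeOf 3) primesEquiv_placeOf_three_val hK hρ j
      continuous_of_discreteTopology loc ι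
  · omega

/-- **W23a `TprimeIrrKodairaThreeStarSerreWeightTwo` (stmt-BirchSwinnertonDyer-28283) by name**: on the tame quartic
class at `3` with `ord₃ Δ_min = 9` the curve is Kodaira `III*`, and on type `III*` every framed model of `E[3] ⊗ k` has
Serre weight `2` at every local restriction datum.
[cite: ConradDiamondTaylor1999, §7.2, proof of Thm. 7.2.1 (p. 553)] -/
theorem tprimeIrrKodairaThreeStarSerreWeightTwo_proof : TprimeIrrKodairaThreeStarSerreWeightTwo := by
  intro W _ _ hadd hsub _hirr hv ρ hρ k _ _ _ _ _ j loc ι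
  haveI : Fact (Nat.Prime 3) := ⟨Nat.prime_three⟩
  rcases TwistPairAtThree.kodairaSymbolAt_and_padicValInt_of_subTprime W hadd hsub with ⟨-, h3⟩ | ⟨hK, -⟩
  · omega
  · exact ThreeTorsionIrreducibleShape.serreWeight_three_eq_two_of_kodairaSymbolAt_IIIstar W (placeOf 3) primesEquiv_placeOf_three_val hK hρ j
      continuous_of_discreteTopology loc ι

end Summit.BirchSwinnertonDyer.BirchSwinnertonDyer.Theorems.TameQuarticManinParity

end
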